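import Mathlib.NumberTheory.PrimeCounting
import Literature.Computability.Complexity.CHPrimes
import Literature.Computability.Complexity.CRRFacts
import HarnessLib

/-!
# Counting primes and blocks of consecutive primes inside the counting hierarchy

Toolkit file (theorems only) of the scaled-up `FOM + MAJ` calculus, preparing the prime bases of
the Chinese-remainder computations (Hesse–Allender–Barrington, JCSS 65 (2002), §4, proof of
Thm. 4.1: "we create numbers `A₁, …, A_s`, each a product of polynomially many distinct short odd
primes … `Aᵢ` can be taken to be `∏_{j=1}^{k} p_{ik+j}` … The list of primes less than `n^{O(1)}`
can be computed by an `FOM` circuit; the prime number theorem guarantees that there are enough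
primes"; Bürgisser, ECCC TR06-113, Thm. 3.4 scales this up to `CH`).

* `piGraph_mem_CH`: the prime-counting function `π'(val x) = #{q < val x prime}` has a `CH` graph
  (an exponential sum of a `CH` indicator, `CHSums.sumGraph_mem_CH`);
* blocks of consecutive primes by index: the set `{q prime | a ≤ π'(q) < b}` is the image of
  `[a, b)` under `j ↦ p_j` (`mem_image_nth_iff`), has `b - a` elements, consists of odd primes when
  `1 ≤ a`, has product `≥ 2^{b-a}`, and lies below `N` as soon as `π'(N) ≥ b`
  (`filter_range_eq_image_nth`); consecutive blocks multiply to the whole range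
  (`prod_image_nth_blocks`);
* the prime supply `π'(2^{4L+11}) ≥ 2^{2L+4}` (`two_pow_le_primeCounting'`, from
  `CRRFacts.two_pow_le_mul_primeCounting`), enough for `2^{L+1} + 1` blocks of `2^{L+2}` primes;
* the block-prime predicate "`val x` is prime and `2^{L+2} ≤ π'(val x) < 2^{L+2}(2^{L+1}+1)`",
  `L = t(|w|)`, read on records `⟨w, x⟩`, is a `CH` language (`blockPrime_mem_CH`), and so is the
  graded predicate "`π'(val x) ∈ [i·2^{L+2}, (i+1)·2^{L+2})`" on `⟨⟨w, bin i⟩, x⟩` (`blockIdx_mem_CH`).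

No new definitions (`π'` is Mathlib's `Nat.primeCounting'`, `p_j` is `Nat.nth Nat.Prime j`).

## References

* W. Hesse, E. Allender, D. A. M. Barrington, JCSS 65 (2002), §4 (proof of Thm. 4.1).
* P. Bürgisser, ECCC TR06-113 (2006), Thm. 3.4.
-/

namespace Literature.Computability.Complexity

open _root_.Computability Polynomial PRelSigma TTClosure Brick PPSharpP ThresholdPP Plumb Finset

/-! ### Constants and indicators -/

/-- The constant function `c` has a graph in `CH` (indeed in `P`). [folklore] -/
theorem constGraph_mem_CH (c : ℕ) : {z | (fun _ : List Bool => c) (fstP z) = bitsToNat (sndP z)} ∈ CH :=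
  mem_CH_of_iff (P_subset_CH (preimage_mem_P (valEqConst_mem_P c) sndP_mem_FP)) _ fun z => by
    change c = bitsToNat (sndP z) ↔ bitsToNat (sndP z) = c
    exact eq_comm

/-- **Indicator functions of `CH` predicates have `CH` graphs**: `w ↦ [Q w]` (definition by cases
between the constants `1` and `0`). [cite: Toran1991, §4] -/
theorem indicatorGraph_mem_CH {Q : List Bool → Prop} [DecidablePred Q] (hQ : ({w | Q w} : Language Bool) ∈ CH) :
    {z | (if Q (fstP z) then 1 else 0) = bitsToNat (sndP z)} ∈ CH :=
  iteGraph_mem_CH' hQ (f := fun _ => 1) (g := fun _ => 0) (constGraph_mem_CH 1) (constGraph_mem_CH 0)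

/-- An indicator is `< 2 = 2^{1}`, in the polynomial form of the toolkit. [folklore] -/
theorem indicator_lt_two_pow (Q : List Bool → Prop) [DecidablePred Q] (w : List Bool) :
    (if Q w then 1 else 0) < 2 ^ (1 : Polynomial ℕ).eval w.length := by
  rw [eval_one, pow_one]
  split_ifs <;> norm_num

/-! ### The prime-counting function -/

/-- **The prime-counting function has a `CH` graph**: `{⟨x, ν⟩ | π'(val x) = val ν} ∈ CH`, where
`π'(n) = #{q < n | q prime}`; it is the exponential sum `∑_{i < 2^{|x|}} [i < val x ∧ i prime]` of a
`CH` indicator ("the list of primes less than `n^{O(1)}` can be computed by an `FOM` circuit",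
HAB 2002, §4, scaled up). [cite: HesseAllenderBarrington2002, Theorem 4.1] -/
theorem piGraph_mem_CH : {z | Nat.primeCounting' (bitsToNat (fstP z)) = bitsToNat (sndP z)} ∈ CH := by
  have hQ : ({w | bitsToNat (sndP w) < bitsToNat (fstP w) ∧ (bitsToNat (sndP w)).Prime} : Language Bool) ∈ CH :=
    mem_CH_of_iff (inter_P_mem_CH gtVal_mem_P (preimage_mem_CH primeVal_mem_CH sndP_mem_FP)) _ fun w => by
      rw [memL_inf']; exact Iff.rfl
  have hS := sumGraph_mem_CH (indicatorGraph_mem_CH hQ)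
    (indicator_lt_two_pow (fun w => bitsToNat (sndP w) < bitsToNat (fstP w) ∧ (bitsToNat (sndP w)).Prime)) X
  refine mem_CH_of_iff hS _ fun z => ?_
  have key : (∑ i ∈ range (2 ^ (fstP z).length), (if i < bitsToNat (fstP z) ∧ i.Prime then 1 else 0)) =
      Nat.primeCounting' (bitsToNat (fstP z)) := by
    rw [sum_boole, Nat.cast_id, Nat.primeCounting', Nat.count_eq_card_filter_range]
    congr 1
    ext i
    simp only [mem_filter, mem_range]
    have := bitsToNat_lt (fstP z)
    constructor
    · rintro ⟨-, hi, hp⟩; exact ⟨hi, hp⟩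
    · rintro ⟨hi, hp⟩; exact ⟨by omega, hi, hp⟩
  change Nat.primeCounting' (bitsToNat (fstP z)) = bitsToNat (sndP z) ↔
    (∑ i ∈ range (2 ^ (X : Polynomial ℕ).eval (fstP z).length),
      (if bitsToNat (sndP (boolPair (fstP z) (encodeNat i))) < bitsToNat (fstP (boolPair (fstP z) (encodeNat i))) ∧
        (bitsToNat (sndP (boolPair (fstP z) (encodeNat i)))).Prime then 1 else 0)) = bitsToNat (sndP z)
  simp only [fstP_boolPair, sndP_boolPair, bitsToNat_encodeNat, eval_X]
  rw [key]

/-- `π'(val x) ≤ val x < 2^{|x|}`. [folklore] -/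
theorem primeCounting'_val_lt (x : List Bool) : Nat.primeCounting' (bitsToNat x) < 2 ^ (X : Polynomial ℕ).eval x.length := by
  rw [eval_X, Nat.primeCounting', Nat.count_eq_card_filter_range]
  exact lt_of_le_of_lt ((card_filter_le _ _).trans (card_range _).le) (bitsToNat_lt x)

/-! ### Blocks of consecutive primes by index -/

/-- **Primes with index in `[a, b)`**: `q ∈ p([a,b))` iff `q` is prime and `a ≤ π'(q) < b`
(`p_j = nth Prime j`, `π'(p_j) = j`). [folklore] -/
theorem mem_image_nth_iff (a b q : ℕ) :
    q ∈ (Ico a b).image (Nat.nth Nat.Prime) ↔ q.Prime ∧ a ≤ Nat.primeCounting' q ∧ Nat.primeCounting' q < b := by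
  constructor
  · intro h
    obtain ⟨j, hj, rfl⟩ := mem_image.1 h
    rw [Nat.primeCounting'_nth_eq]
    exact ⟨Nat.prime_nth_prime j, (mem_Ico.1 hj).1, (mem_Ico.1 hj).2⟩
  · rintro ⟨hq, ha, hb⟩
    refine mem_image.2 ⟨Nat.primeCounting' q, mem_Ico.2 ⟨ha, hb⟩, ?_⟩
    exact Nat.nth_count hq

/-- The block `p([a,b))` has `b - a` elements. [folklore] -/
theorem card_image_nth (a b : ℕ) : ((Ico a b).image (Nat.nth Nat.Prime)).card = b - a := by
  rw [card_image_of_injective _ (Nat.nth_injective Nat.infinite_setOf_prime), Nat.card_Ico]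

/-- Elements of `p([a,b))` with `1 ≤ a` are odd primes. [folklore] -/
theorem prime_and_odd_of_mem_image_nth {a b q : ℕ} (ha : 1 ≤ a) (h : q ∈ (Ico a b).image (Nat.nth Nat.Prime)) :
    q.Prime ∧ q % 2 = 1 := by
  obtain ⟨j, hj, rfl⟩ := mem_image.1 h
  refine ⟨Nat.prime_nth_prime j, ?_⟩
  have h2 : Nat.nth Nat.Prime 0 < Nat.nth Nat.Prime j :=
    (Nat.nth_lt_nth Nat.infinite_setOf_prime).2 (by have := (mem_Ico.1 hj).1; omega)
  rw [Nat.nth_prime_zero_eq_two] at h2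
  rcases (Nat.prime_nth_prime j).eq_two_or_odd' with h | h
  · omega
  · exact Nat.odd_iff.1 h

/-- The product of the block `p([a,b))` is at least `2^{b-a}`. [folklore] -/
theorem two_pow_le_prod_image_nth (a b : ℕ) : 2 ^ (b - a) ≤ ∏ q ∈ (Ico a b).image (Nat.nth Nat.Prime), q := by
  rw [← card_image_nth a b]
  exact pow_card_le_prod _ _ 2 fun q hq => by
    obtain ⟨j, -, rfl⟩ := mem_image.1 hq
    exact (Nat.prime_nth_prime j).two_le

/-- **A block lies below any bound with enough primes below it**: if `b ≤ π'(N)` then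
`{q < N | q prime, a ≤ π'(q) < b} = p([a,b))`. [folklore] -/
theorem filter_range_eq_image_nth {a b N : ℕ} (hN : b ≤ Nat.primeCounting' N) :
    (range N).filter (fun q => q.Prime ∧ a ≤ Nat.primeCounting' q ∧ Nat.primeCounting' q < b) =
      (Ico a b).image (Nat.nth Nat.Prime) := by
  ext q
  rw [mem_filter, mem_range, mem_image_nth_iff]
  constructor
  · rintro ⟨-, h⟩; exact h
  · rintro ⟨hq, ha, hb⟩
    refine ⟨?_, hq, ha, hb⟩
    have h1 : Nat.nth Nat.Prime (Nat.count Nat.Prime q) < N := Nat.nth_lt_of_lt_count (lt_of_lt_of_le hb hN)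
    rwa [Nat.nth_count hq] at h1

/-- Every prime with `π'(q) < b ≤ π'(N)` is below `N`. [folklore] -/
theorem lt_of_primeCounting'_lt {q b N : ℕ} (hq : q.Prime) (hb : Nat.primeCounting' q < b) (hN : b ≤ Nat.primeCounting' N) :
    q < N := by
  have h1 : Nat.nth Nat.Prime (Nat.count Nat.Prime q) < N := Nat.nth_lt_of_lt_count (lt_of_lt_of_le hb hN)
  rwa [Nat.nth_count hq] at h1

/-- **Consecutive blocks multiply to the whole index range**:
`∏_{q ∈ p([K, K(N+1)))} q = ∏_{i<N} ∏_{q ∈ p([(i+1)K, (i+2)K))} q`. [folklore] -/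
theorem prod_image_nth_blocks (K N : ℕ) :
    ∏ q ∈ (Ico K (K * (N + 1))).image (Nat.nth Nat.Prime), q =
      ∏ i ∈ range N, ∏ q ∈ (Ico ((i + 1) * K) ((i + 2) * K)).image (Nat.nth Nat.Prime), q := by
  have hinj := Nat.nth_injective Nat.infinite_setOf_prime
  rw [prod_image fun x _ y _ h => hinj h]
  simp_rw [prod_image fun x _ y _ h => hinj h]
  induction N with
  | zero => simp
  | succ n ih =>
    rw [prod_range_succ, ← ih, show (n + 1) * K = K * (n + 1) by ring, show (n + 2) * K = K * (n + 1 + 1) by ring]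
    exact (prod_Ico_consecutive _ (Nat.le_mul_of_pos_right K (Nat.succ_pos n))
      (Nat.mul_le_mul_left K (Nat.le_succ _))).symm

/-! ### The prime supply -/

/-- `4L + 11 ≤ 2^{2L+4}`. [folklore] -/
theorem four_mul_add_le_two_pow (L : ℕ) : 4 * L + 11 ≤ 2 ^ (2 * L + 4) := by
  induction L with
  | zero => norm_num
  | succ n ih => rw [show 2 * (n + 1) + 4 = 2 * n + 4 + 2 by ring, pow_add]; omega

/-- **Prime supply**: `2^{2L+4} ≤ π'(2^{4L+11})`, i.e. there are at least `2^{2L+4}` primes below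
`2^{4L+11}` (from the Chebyshev bound `2ᵗ ≤ t π(2ᵗ) + t + 1` of `CRRFacts`; "the prime number theorem
guarantees that there are enough primes", HAB 2002, §4). [cite: HesseAllenderBarrington2002, §4] -/
theorem two_pow_le_primeCounting' (L : ℕ) : 2 ^ (2 * L + 4) ≤ Nat.primeCounting' (2 ^ (4 * L + 11)) := by
  have h := two_pow_le_mul_primeCounting (4 * L + 10)
  -- `π(2ᵘ) = π'(2ᵘ + 1) ≤ π'(2^{u+1})`
  have hmono : Nat.primeCounting (2 ^ (4 * L + 10)) ≤ Nat.primeCounting' (2 ^ (4 * L + 11)) := by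
    rw [Nat.primeCounting_eq_primeCounting'_succ]
    refine Nat.monotone_primeCounting' ?_
    calc 2 ^ (4 * L + 10) + 1 ≤ 2 ^ (4 * L + 10) + 2 ^ (4 * L + 10) := by
          have := Nat.one_le_two_pow (n := 4 * L + 10); omega
      _ = 2 ^ (4 * L + 11) := by rw [← two_mul, ← pow_succ']
  have hsplit : 2 ^ (4 * L + 10) = 2 ^ (2 * L + 4) * 2 ^ (2 * L + 6) := by rw [← pow_add]; congr 1; ring
  have hsup : 4 * L + 11 ≤ 2 ^ (2 * L + 6) :=
    (four_mul_add_le_two_pow L).trans (Nat.pow_le_pow_right (by norm_num) (by omega))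
  by_contra hlt
  push Not at hlt
  -- linear facts over the atoms `(4L+10)·π(2ᵘ)`, `(4L+10)·2^{2L+4}`, `2^{2L+4}·(4L+11)`, `2^{2L+4}·2^{2L+6}`
  have h1 : (4 * L + 10) * Nat.primeCounting (2 ^ (4 * L + 10)) + (4 * L + 10) ≤ (4 * L + 10) * 2 ^ (2 * L + 4) := by
    have := Nat.mul_le_mul_left (4 * L + 10)
      (show Nat.primeCounting (2 ^ (4 * L + 10)) + 1 ≤ 2 ^ (2 * L + 4) from lt_of_le_of_lt hmono hlt)
    rwa [Nat.mul_succ] at this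
  have h2 : 2 ^ (2 * L + 4) * (4 * L + 11) ≤ 2 ^ (2 * L + 4) * 2 ^ (2 * L + 6) := Nat.mul_le_mul_left _ hsup
  have e1 : 2 ^ (2 * L + 4) * (4 * L + 11) = (4 * L + 10) * 2 ^ (2 * L + 4) + 2 ^ (2 * L + 4) := by ring
  have ha : 2 ≤ 2 ^ (2 * L + 4) :=
    calc (2 : ℕ) = 2 ^ 1 := by norm_num
      _ ≤ 2 ^ (2 * L + 4) := Nat.pow_le_pow_right (by norm_num) (by omega)
  have h' := hsplit.symm.le.trans h
  linarith

/-- The index ranges used for the blocks fit under the supply: `2^{L+2}(2^{L+1}+1) ≤ 2^{2L+4}`. [folklore] -/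
theorem blockRange_le_two_pow (L : ℕ) : 2 ^ (L + 2) * (2 ^ (L + 1) + 1) ≤ 2 ^ (2 * L + 4) := by
  rw [show 2 * L + 4 = (L + 2) + (L + 2) by ring, pow_add (2 : ℕ) (L + 2) (L + 2)]
  refine Nat.mul_le_mul_left _ ?_
  rw [show L + 2 = (L + 1) + 1 by ring, pow_succ]
  have := Nat.one_le_two_pow (n := L + 1)
  omega

/-! ### The block-prime predicates in `CH` -/

section BlockPred

variable (t : Polynomial ℕ)

/-- The numeral `bin 2^{p(|w|)} = 0^{p|w|} 1` as a polynomial-time function of `w`. [folklore] -/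
theorem pow2LenFn_mem_FP (p : Polynomial ℕ) : (fun w => Kannan.zerosFn (polyFn p w) ++ [true]) ∈ FP :=
  append_mem_FP (comp_mem_FP Kannan.zerosFn_mem_FP (polyFn_mem_FP p)) (const_mem_FP [true])

/-- Its value: `val (0^{p|w|} 1) = 2^{p|w|}`. [folklore] -/
theorem bitsToNat_pow2LenFn (p : Polynomial ℕ) (w : List Bool) :
    bitsToNat (Kannan.zerosFn (polyFn p w) ++ [true]) = 2 ^ p.eval w.length := by
  rw [bitsToNat_append, Kannan.zerosFn_apply, bitsToNat_replicate_false, List.length_replicate, polyFn_apply]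
  simp [ones]

/-- **The block-prime predicate is a `CH` language**: on records `r = ⟨w, x⟩`, "`val x` is prime and
`2^{L+2} ≤ π'(val x) < 2^{L+2} · (2^{L+1} + 1)`", `L = t(|w|)` (primality, and two comparisons of the
`CH`-graph function `π'` with polynomial-time numerals). [cite: HesseAllenderBarrington2002, Theorem 4.1] -/
theorem blockPrime_mem_CH :
    ({r | (bitsToNat (sndP r)).Prime ∧ 2 ^ (t.eval (fstP r).length + 2) ≤ Nat.primeCounting' (bitsToNat (sndP r)) ∧
        Nat.primeCounting' (bitsToNat (sndP r)) < 2 ^ (t.eval (fstP r).length + 2) * (2 ^ (t.eval (fstP r).length + 1) + 1)} :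
      Language Bool) ∈ CH := by
  have hPr : sndP ⁻¹' ({w | (bitsToNat w).Prime} : Language Bool) ∈ CH := preimage_mem_CH primeVal_mem_CH sndP_mem_FP
  -- `K' ≤ π'(x)` as the preimage of `{⟨x, ν⟩ | val ν ≤ π'(val x)}` under `r ↦ ⟨x, bin K'⟩`
  have hK' : (fun w => Kannan.zerosFn (polyFn (t + 2) w) ++ [true]) ∈ FP := pow2LenFn_mem_FP (t + 2)
  have hNB1 : addFn ∘ pairFn (fun w => Kannan.zerosFn (polyFn (t + 1) w) ++ [true]) (fun _ => encodeNat 1) ∈ FP :=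
    comp_mem_FP addFn_mem_FP (pairFn_mem_FP (pow2LenFn_mem_FP (t + 1)) (const_mem_FP _))
  have hGe := preimage_mem_CH (geGraph_mem_CH piGraph_mem_CH primeCounting'_val_lt)
    (pairFn_mem_FP sndP_mem_FP (comp_mem_FP hK' fstP_mem_FP))
  have hLt := preimage_mem_CH (ltGraph_mem_CH piGraph_mem_CH primeCounting'_val_lt)
    (pairFn_mem_FP sndP_mem_FP (comp_mem_FP prodFn_mem_FP (pairFn_mem_FP (comp_mem_FP hK' fstP_mem_FP)
      (comp_mem_FP hNB1 fstP_mem_FP))))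
  refine mem_CH_of_iff (inter_mem_CH hPr (inter_mem_CH hGe hLt)) _ fun r => ?_
  rw [memL_inf', memL_inf']
  change _ ↔ (bitsToNat (sndP r)).Prime ∧
    bitsToNat (sndP (pairFn sndP ((fun w => Kannan.zerosFn (polyFn (t + 2) w) ++ [true]) ∘ fstP) r)) ≤
        Nat.primeCounting' (bitsToNat (fstP (pairFn sndP ((fun w => Kannan.zerosFn (polyFn (t + 2) w) ++ [true]) ∘ fstP) r))) ∧
      Nat.primeCounting' (bitsToNat (fstP (pairFn sndP (prodFn ∘ pairFn ((fun w => Kannan.zerosFn (polyFn (t + 2) w) ++ [true]) ∘ fstP)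
          ((addFn ∘ pairFn (fun w => Kannan.zerosFn (polyFn (t + 1) w) ++ [true]) (fun _ => encodeNat 1)) ∘ fstP)) r))) <
        bitsToNat (sndP (pairFn sndP (prodFn ∘ pairFn ((fun w => Kannan.zerosFn (polyFn (t + 2) w) ++ [true]) ∘ fstP)
          ((addFn ∘ pairFn (fun w => Kannan.zerosFn (polyFn (t + 1) w) ++ [true]) (fun _ => encodeNat 1)) ∘ fstP)) r))
  simp only [pairFn_apply, Function.comp_apply, fstP_boolPair, sndP_boolPair, prodFn_boolPair, addFn_boolPair,
    bitsToNat_encodeNat, bitsToNat_pow2LenFn, eval_add, eval_ofNat, eval_one]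
  exact Iff.rfl

/-- **The graded block predicate is a `CH` language**: on records `w'' = ⟨⟨w, bin i⟩, x⟩`, "`val x` is
prime and `i · 2^{L+2} ≤ π'(val x) < (i + 1) · 2^{L+2}`", `L = t(|w|)` — membership of the prime `val x`
in the `i`-th block. [cite: HesseAllenderBarrington2002, Theorem 4.1] -/
theorem blockIdx_mem_CH :
    ({r | (bitsToNat (sndP r)).Prime ∧
        bitsToNat (sndP (fstP r)) * 2 ^ (t.eval (fstP (fstP r)).length + 2) ≤ Nat.primeCounting' (bitsToNat (sndP r)) ∧
        Nat.primeCounting' (bitsToNat (sndP r)) < (bitsToNat (sndP (fstP r)) + 1) * 2 ^ (t.eval (fstP (fstP r)).length + 2)} :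
      Language Bool) ∈ CH := by
  have hPr : sndP ⁻¹' ({w | (bitsToNat w).Prime} : Language Bool) ∈ CH := preimage_mem_CH primeVal_mem_CH sndP_mem_FP
  have hK' : (fun w => Kannan.zerosFn (polyFn (t + 2) w) ++ [true]) ∘ fstP ∘ fstP ∈ FP :=
    comp_mem_FP (pow2LenFn_mem_FP (t + 2)) (comp_mem_FP fstP_mem_FP fstP_mem_FP)
  have hLo : prodFn ∘ pairFn (sndP ∘ fstP) ((fun w => Kannan.zerosFn (polyFn (t + 2) w) ++ [true]) ∘ fstP ∘ fstP) ∈ FP :=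
    comp_mem_FP prodFn_mem_FP (pairFn_mem_FP (comp_mem_FP sndP_mem_FP fstP_mem_FP) hK')
  have hHi : prodFn ∘ pairFn (addFn ∘ pairFn (sndP ∘ fstP) (fun _ => encodeNat 1))
      ((fun w => Kannan.zerosFn (polyFn (t + 2) w) ++ [true]) ∘ fstP ∘ fstP) ∈ FP :=
    comp_mem_FP prodFn_mem_FP (pairFn_mem_FP (comp_mem_FP addFn_mem_FP (pairFn_mem_FP (comp_mem_FP sndP_mem_FP fstP_mem_FP)
      (const_mem_FP _))) hK')
  have hGe := preimage_mem_CH (geGraph_mem_CH piGraph_mem_CH primeCounting'_val_lt) (pairFn_mem_FP sndP_mem_FP hLo)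
  have hLt := preimage_mem_CH (ltGraph_mem_CH piGraph_mem_CH primeCounting'_val_lt) (pairFn_mem_FP sndP_mem_FP hHi)
  refine mem_CH_of_iff (inter_mem_CH hPr (inter_mem_CH hGe hLt)) _ fun r => ?_
  rw [memL_inf', memL_inf']
  change _ ↔ (bitsToNat (sndP r)).Prime ∧
    bitsToNat (sndP (pairFn sndP (prodFn ∘ pairFn (sndP ∘ fstP) ((fun w => Kannan.zerosFn (polyFn (t + 2) w) ++ [true]) ∘ fstP ∘ fstP)) r)) ≤
        Nat.primeCounting' (bitsToNat (fstP (pairFn sndP (prodFn ∘ pairFn (sndP ∘ fstP)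
          ((fun w => Kannan.zerosFn (polyFn (t + 2) w) ++ [true]) ∘ fstP ∘ fstP)) r))) ∧
      Nat.primeCounting' (bitsToNat (fstP (pairFn sndP (prodFn ∘ pairFn (addFn ∘ pairFn (sndP ∘ fstP) (fun _ => encodeNat 1))
          ((fun w => Kannan.zerosFn (polyFn (t + 2) w) ++ [true]) ∘ fstP ∘ fstP)) r))) <
        bitsToNat (sndP (pairFn sndP (prodFn ∘ pairFn (addFn ∘ pairFn (sndP ∘ fstP) (fun _ => encodeNat 1))
          ((fun w => Kannan.zerosFn (polyFn (t + 2) w) ++ [true]) ∘ fstP ∘ fstP)) r))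
  simp only [pairFn_apply, Function.comp_apply, fstP_boolPair, sndP_boolPair, prodFn_boolPair, addFn_boolPair,
    bitsToNat_encodeNat, bitsToNat_pow2LenFn, eval_add, eval_ofNat]
  exact Iff.rfl

end BlockPred

end Literature.Computability.Complexity
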